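import Summits.ResolutionOfSingularities.KangarooAtlas.MizutaniTowerDerivation
import Summits.ResolutionOfSingularities.KangarooAtlas.MizutaniOperatorBasis
import Literature.FieldTheory.Separability.PIndependentDerivations
import HarnessLib

/-!
# The step structure of the tower profile at exponent one: `Θ_{m+1}(v) = Θ_m(v) + Σ_l ∂_l Θ_m(v)` (Mizutani 1973, proof of Thm. 2.8)

Cell `pub-rosobs`, Mizutani enclosure (seat mizutani-encloser-2, gen 7). AI-written; AI review is weaker than expert
review; NOT a resolution-of-singularities theorem (summit relevance C).

Mizutani's proof of Thm. 2.8 (Nagoya Math. J. 52 (1973), p. 90) climbs the chain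
`Diff_1(k)f ⊂ Diff_2(k)f ⊂ ⋯ ⊂ Diff_{p−1}(k)f = θ_1(f)` one order at a time, using that at exponent one the
differential operators of order `≤ m + 1` are generated by those of order `≤ m` and the DERIVATIONS.  This file proves the
corresponding structure for the tree's tower spans `Θ_m(v) = h.thetaSpan m v` (`MizutaniExtremalProfile.lean`) of a root tower
`h : IsRootTower L K q x a` and its anti-Hasse–Schmidt operators `sigD_T` (`MizutaniRootTowerBridge.lean`):

* `coeff_aeval_neg_X`, **`IsRootTower.sigD_eq_neg_one_pow_mul_hsD`** (`sigD_T = (−1)^{|T|} D^{(T)}`: the anti-Taylor morphism is the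
  Taylor morphism followed by `u ↦ −u`), hence the COMPOSITION RULE **`IsRootTower.sigD_sigD`**
  (`sigD_S ∘ sigD_T = C(S+T,T) sigD_{S+T}`, from encloser-1's `hsD_hsD`) and `sigD_single_sigD` (`∂_l ∘ sigD_T = (T_l + 1) sigD_{T+e_l}`);
* `IsRootTower.thetaSpan_mono`, **`IsRootTower.der_mem_thetaSpan_succ`** (`∂_l Θ_m(v) ⊆ Θ_{m+1}(v)`), `der_mem_span_union_derivSet`,
  and at exponent one **`IsRootTower.thetaSpan_succ_eq_span`**: `Θ_{m+1}(v) = span_K (S ∪ ∂S)` for every spanning set `S` of `Θ_m(v)`;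
* **`IsRootTower.derivation_eq_sum_der`** (every `L`-derivation of `K` is `Σ_l −D(a_l)·∂_l`), and — via the Literature theorem
  `exists_derivation_eq_one_eqOn_zero` (Matsumura §26: derivations with prescribed zeros) — **`IsRootTower.exists_eq_algebraMap_of_der_eq_zero`**
  (the joint kernel of the `∂_l` is `L`) and **`IsRootTower.mem_adjoin_simple_of_der_eq_mul`** (if `dz` is proportional to `dα` then
  `z ∈ L(α)`: the Jacobian criterion for one element), for towers with `K^p ⊆ L`.

## References

* H. Mizutani, *Hironaka's additive group schemes*, Nagoya Math. J. 52 (1973) 85–95, proof of Thm. 2.8 (p. 90: «We claim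
  dim_k Diff_{i+1}(k)f ≥ dim_k Diff_i(k)f + 2»). [Mizutani1973HironakaGroupSchemes]
* A. Grothendieck, EGA IV₄, Thm. 16.11.2 (Hasse–Schmidt operators of a `p`-basis, iterativity). [EGAIV4]
* H. Matsumura, *Commutative Ring Theory*, §26 (p-bases and derivations). [Matsumura1987]
-/

noncomputable section

open MvPolynomial Literature.AlgebraicGeometry.Resolution

namespace Summit.ResolutionOfSingularities.KangarooAtlas.Mizutani

universe u

/-! ## `sigD_T = (−1)^{|T|} D^{(T)}` and the composition rule for `sigD` -/

section Sign

/-- Substituting `X_i ↦ −X_i` multiplies the `X^T`-coefficient by `(−1)^{|T|}`. [folklore] -/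
theorem coeff_aeval_neg_X {R : Type*} [CommRing R] {σ : Type*} (f : MvPolynomial σ R) (T : σ →₀ ℕ) :
    coeff T (aeval (fun i => -(X i : MvPolynomial σ R)) f) = (-1) ^ T.degree * coeff T f := by
  classical
  have hmon : ∀ (d : σ →₀ ℕ) (r : R),
      aeval (fun i => -(X i : MvPolynomial σ R)) (monomial d r) = monomial d ((-1) ^ d.degree * r) := by
    intro d r
    rw [aeval_monomial, algebraMap_eq]
    have hprod : (d.prod fun i k => (-(X i : MvPolynomial σ R)) ^ k) =
        C ((-1 : R) ^ d.degree) * monomial d 1 := by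
      rw [Finsupp.prod, ← prod_X_pow_eq_monomial,
        Finset.prod_congr rfl fun i _ => neg_pow (X i : MvPolynomial σ R) (d i),
        Finset.prod_mul_distrib, Finset.prod_pow_eq_pow_sum, Finsupp.degree_apply, map_pow, map_neg, C_1]
    rw [hprod, ← mul_assoc, ← map_mul, C_mul_monomial, mul_one, mul_comm]
  conv_lhs => rw [f.as_sum, map_sum, coeff_sum]
  simp_rw [hmon, coeff_monomial]
  rw [Finset.sum_ite_eq']
  split_ifs with hT
  · rfl
  · rw [notMem_support_iff.mp hT, mul_zero]

variable {L K : Type u} [Field L] [Field K] [Algebra L K] {s p e : ℕ} [hp : Fact p.Prime] [CharP K p]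
  {x : Fin s → L} {a : Fin s → K}

/-- **`sigD_T = (−1)^{|T|} D^{(T)}`**: the anti-Hasse–Schmidt operators of the tower (coefficients of `a ↦ a − u`) are the
Hasse–Schmidt operators (coefficients of `a ↦ a + u`) up to the sign `(−1)^{|T|}` — checked on the box monomials `a^N`,
where `sig a^N = ∏ (a_i − u_i)^{N_i}` is `∏ (a_i + u_i)^{N_i}` with `u ↦ −u`. [cite: EGAIV4, Thm. 16.11.2] -/
theorem IsRootTower.sigD_eq_neg_one_pow_mul_hsD (h : IsRootTower L K (p ^ e) x a) (T : Fin s →₀ ℕ) (y : K) :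
    h.sigD T y = (-1) ^ T.degree * h.hsD T y := by
  classical
  by_cases hT : InBox (p ^ e) T
  · suffices hfun : h.sigD T = ((-1 : L) ^ T.degree) • h.hsD T by
      have := congrArg (fun Φ : K →ₗ[L] K => Φ y) hfun
      simp only [LinearMap.smul_apply] at this
      rw [this, Algebra.smul_def, map_pow, map_neg, map_one]
    refine h.linearMap_ext_boxMonomials fun N _ => ?_
    rw [LinearMap.smul_apply, Algebra.smul_def, map_pow, map_neg, map_one]
    -- `sig a^N = [∏ (C a_i − X_i)^{N_i}] = [aeval (−X) (pPlus a N)]`, `tau a^N = [pPlus a N]`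
    have hsig : h.sig (∏ i, a i ^ N i) =
        Ideal.Quotient.mk _ (aeval (fun i => -(X i : MvPolynomial (Fin s) K)) (pPlus a N)) := by
      unfold pPlus
      rw [map_prod, map_prod, map_prod]
      refine Finset.prod_congr rfl fun i _ => ?_
      rw [map_pow, map_pow, map_pow, h.sig_gen, map_add, aeval_C, aeval_X, algebraMap_eq, sub_eq_add_neg]
    rw [h.sigD_apply, h.hsD_apply, hsig, h.tau_prod_pow, truncQ_mk, truncQ_mk, coeff_trunc, coeff_trunc, if_pos hT,
      if_pos hT, coeff_aeval_neg_X]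
  · rw [h.sigD_eq_zero_of_not_inBox hT, h.hsD_eq_zero_of_not_inBox hT, mul_zero]

/-- `D^{(S)}((−1)^n y) = (−1)^n D^{(S)} y`. [folklore] -/
theorem IsRootTower.hsD_neg_one_pow_mul (h : IsRootTower L K (p ^ e) x a) (S : Fin s →₀ ℕ) (n : ℕ) (y : K) :
    h.hsD S ((-1) ^ n * y) = (-1) ^ n * h.hsD S y := by
  rcases neg_one_pow_eq_or K n with h1 | h1 <;> rw [h1]
  · rw [one_mul, one_mul]
  · rw [neg_one_mul, neg_one_mul, map_neg]

/-- **Composition rule for the anti-Hasse–Schmidt operators**: `sigD_S (sigD_T y) = C(S+T,T) · sigD_{S+T} y` (the sign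
`(−1)^{|S|+|T|} = (−1)^{|S+T|}` is compatible with `hsD_hsD`). [cite: EGAIV4, Thm. 16.11.2 ((16.11.2.2) iterativity)] -/
theorem IsRootTower.sigD_sigD (h : IsRootTower L K (p ^ e) x a) (S T : Fin s →₀ ℕ) (y : K) :
    h.sigD S (h.sigD T y) = (mchoose (S + T) T : K) * h.sigD (S + T) y := by
  rw [h.sigD_eq_neg_one_pow_mul_hsD, h.sigD_eq_neg_one_pow_mul_hsD, h.sigD_eq_neg_one_pow_mul_hsD,
    h.hsD_neg_one_pow_mul, h.hsD_hsD, map_add, pow_add]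
  ring

/-- `C(e_l + T, T) = T_l + 1`. [folklore] -/
theorem mchoose_single_add (l : Fin s) (T : Fin s →₀ ℕ) :
    mchoose (Finsupp.single l 1 + T) T = T l + 1 := by
  classical
  rw [mchoose_eq_prod, Finset.prod_eq_single l]
  · rw [Finsupp.add_apply, Finsupp.single_eq_same, add_comm, Nat.choose_succ_self_right]
  · intro i _ hil
    rw [Finsupp.add_apply, Finsupp.single_eq_of_ne hil, zero_add, Nat.choose_self]
  · intro hl; exact absurd (Finset.mem_univ l) hl

/-- **`∂_l ∘ sigD_T = (T_l + 1) · sigD_{T + e_l}`** (both sides vanish when `T + e_l` leaves the box).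
[cite: EGAIV4, Thm. 16.11.2 ((16.11.2.2))] -/
theorem IsRootTower.sigD_single_sigD (h : IsRootTower L K (p ^ e) x a) (l : Fin s) (T : Fin s →₀ ℕ) (y : K) :
    h.sigD (Finsupp.single l 1) (h.sigD T y) = ((T l + 1 : ℕ) : K) * h.sigD (T + Finsupp.single l 1) y := by
  rw [h.sigD_sigD, mchoose_single_add, add_comm T]

/-- The anti-Hasse–Schmidt operators commute. [cite: EGAIV4, Thm. 16.11.2 ((16.11.2.2))] -/
theorem IsRootTower.sigD_comm (h : IsRootTower L K (p ^ e) x a) (S T : Fin s →₀ ℕ) (y : K) :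
    h.sigD S (h.sigD T y) = h.sigD T (h.sigD S y) := by
  rw [h.sigD_eq_neg_one_pow_mul_hsD T y, h.sigD_eq_neg_one_pow_mul_hsD S y, h.sigD_eq_neg_one_pow_mul_hsD S,
    h.sigD_eq_neg_one_pow_mul_hsD T, h.hsD_neg_one_pow_mul, h.hsD_neg_one_pow_mul, h.hsD_comm]
  ring

end Sign

/-! ## `∂_l Θ_m(v) ⊆ Θ_{m+1}(v)` and `Θ_{m+1}(v) = span (S ∪ ∂S)` at exponent one -/

section Step

variable {L K : Type u} [Field L] [Field K] [Algebra L K] {s p e : ℕ} [hp : Fact p.Prime] [CharP K p]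
  {x : Fin s → L} {a : Fin s → K} {ι : Type*}

/-- The coordinatewise derivative `∂_l g = (sigD_{e_l} g_i)_i` of a vector. [folklore] -/
def IsRootTower.dvec (h : IsRootTower L K (p ^ e) x a) (l : Fin s) (g : ι → K) : ι → K :=
  fun i => h.sigD (Finsupp.single l 1) (g i)

/-- `∂_l g` unfolded. [folklore] -/
theorem IsRootTower.dvec_apply (h : IsRootTower L K (p ^ e) x a) (l : Fin s) (g : ι → K) (i : ι) :
    h.dvec l g i = h.sigD (Finsupp.single l 1) (g i) := rfl

/-- `∂_l` is additive on vectors. [folklore] -/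
theorem IsRootTower.dvec_add (h : IsRootTower L K (p ^ e) x a) (l : Fin s) (g g' : ι → K) :
    h.dvec l (g + g') = h.dvec l g + h.dvec l g' := by
  funext i; simp [IsRootTower.dvec_apply, map_add]

/-- `∂_l 0 = 0`. [folklore] -/
theorem IsRootTower.dvec_zero (h : IsRootTower L K (p ^ e) x a) (l : Fin s) : h.dvec l (0 : ι → K) = 0 := by
  funext i; simp [IsRootTower.dvec_apply]

/-- **Leibniz on vectors**: `∂_l (c · g) = (∂_l c) · g + c · ∂_l g`. [cite: EGAIV4, Thm. 16.11.2] -/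
theorem IsRootTower.dvec_smul (h : IsRootTower L K (p ^ e) x a) (he : 1 ≤ e) (l : Fin s) (c : K) (g : ι → K) :
    h.dvec l (c • g) = h.sigD (Finsupp.single l 1) c • g + c • h.dvec l g := by
  funext i
  simp only [IsRootTower.dvec_apply, Pi.add_apply, Pi.smul_apply, smul_eq_mul]
  rw [h.sigD_single_mul he]

/-- `Θ_m(v)` is monotone in `m`. [folklore] -/
theorem IsRootTower.thetaSpan_mono (h : IsRootTower L K (p ^ e) x a) {m m' : ℕ} (hmm' : m ≤ m') (v : ι → K) :
    h.thetaSpan m v ≤ h.thetaSpan m' v := by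
  unfold IsRootTower.thetaSpan
  refine Submodule.span_mono (Set.image_mono fun T hT => ?_)
  rw [Finset.mem_coe, mem_degLE] at hT ⊢
  exact hT.trans hmm'

/-- The generator `(sigD_T v_i)_i` lies in `Θ_m(v)` for `|T| ≤ m`. [folklore] -/
theorem IsRootTower.sigD_vec_mem_thetaSpan (h : IsRootTower L K (p ^ e) x a) {m : ℕ} (v : ι → K) {T : Fin s →₀ ℕ}
    (hT : T.degree ≤ m) : (fun i => h.sigD T (v i)) ∈ h.thetaSpan m v := by
  unfold IsRootTower.thetaSpan
  exact Submodule.subset_span ⟨T, Finset.mem_coe.mpr (mem_degLE.mpr hT), rfl⟩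

/-- `v ∈ Θ_m(v)`. [folklore] -/
theorem IsRootTower.self_mem_thetaSpan (h : IsRootTower L K (p ^ e) x a) (m : ℕ) (v : ι → K) : v ∈ h.thetaSpan m v := by
  have := h.sigD_vec_mem_thetaSpan (m := m) v (T := 0) (by simp)
  have h0 : (fun i => h.sigD 0 (v i)) = v := by funext i; rw [h.sigD_zero, LinearMap.id_apply]
  rwa [h0] at this

/-- **`∂_l Θ_m(v) ⊆ Θ_{m+1}(v)`**: on a generator, `∂_l (sigD_T v) = (T_l + 1) sigD_{T+e_l} v`; in general by Leibniz.
[cite: Mizutani1973HironakaGroupSchemes, proof of Thm. 2.8 (Diff_{i+1}(k)f ⊇ Der(k)·Diff_i(k)f)] -/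
theorem IsRootTower.dvec_mem_thetaSpan_succ (h : IsRootTower L K (p ^ e) x a) (he : 1 ≤ e) {m : ℕ} (v : ι → K) (l : Fin s)
    {θ : ι → K} (hθ : θ ∈ h.thetaSpan m v) : h.dvec l θ ∈ h.thetaSpan (m + 1) v := by
  unfold IsRootTower.thetaSpan at hθ
  induction hθ using Submodule.span_induction with
  | mem g hg =>
    obtain ⟨T, hT, rfl⟩ := hg
    have hT' : T.degree ≤ m := mem_degLE.mp (Finset.mem_coe.mp hT)
    have hfun : h.dvec l (fun i => h.sigD T (v i)) =
        ((T l + 1 : ℕ) : K) • fun i => h.sigD (T + Finsupp.single l 1) (v i) := by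
      funext i
      rw [h.dvec_apply, Pi.smul_apply, smul_eq_mul, h.sigD_single_sigD]
    rw [hfun]
    refine Submodule.smul_mem _ _ (h.sigD_vec_mem_thetaSpan v ?_)
    rw [map_add, Finsupp.degree_single]; omega
  | zero => rw [h.dvec_zero]; exact Submodule.zero_mem _
  | add g g' _ _ hg hg' => rw [h.dvec_add]; exact Submodule.add_mem _ hg hg'
  | smul c g hg hcg =>
    rw [h.dvec_smul he]
    refine Submodule.add_mem _ (Submodule.smul_mem _ _ ?_) (Submodule.smul_mem _ _ hcg)
    exact h.thetaSpan_mono (Nat.le_succ m) v hg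

/-- The set `∂S = {∂_l g : l, g ∈ S}` of first derivatives of a set of vectors. [folklore] -/
def IsRootTower.derivSet (h : IsRootTower L K (p ^ e) x a) (S : Set (ι → K)) : Set (ι → K) :=
  {g' | ∃ l : Fin s, ∃ g ∈ S, g' = h.dvec l g}

/-- `∂_l g ∈ ∂S` for `g ∈ S`. [folklore] -/
theorem IsRootTower.dvec_mem_derivSet (h : IsRootTower L K (p ^ e) x a) {S : Set (ι → K)} (l : Fin s) {g : ι → K}
    (hg : g ∈ S) : h.dvec l g ∈ h.derivSet S := ⟨l, g, hg, rfl⟩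

/-- **Derivatives of a span**: `∂_l (span_K S) ⊆ span_K (S ∪ ∂S)` (Leibniz). [folklore] -/
theorem IsRootTower.dvec_mem_span_union_derivSet (h : IsRootTower L K (p ^ e) x a) (he : 1 ≤ e) (S : Set (ι → K))
    (l : Fin s) {θ : ι → K} (hθ : θ ∈ Submodule.span K S) : h.dvec l θ ∈ Submodule.span K (S ∪ h.derivSet S) := by
  induction hθ using Submodule.span_induction with
  | mem g hg => exact Submodule.subset_span (Or.inr (h.dvec_mem_derivSet l hg))
  | zero => rw [h.dvec_zero]; exact Submodule.zero_mem _
  | add g g' _ _ hg hg' => rw [h.dvec_add]; exact Submodule.add_mem _ hg hg'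
  | smul c g hg hcg =>
    rw [h.dvec_smul he]
    refine Submodule.add_mem _ (Submodule.smul_mem _ _ ?_) (Submodule.smul_mem _ _ hcg)
    exact Submodule.span_mono Set.subset_union_left hg

variable {x₁ : Fin s → L} {a₁ : Fin s → K}

/-- **The step structure at exponent one**: if `S ⊆ Θ_m(v)` spans `Θ_m(v)`, then `Θ_{m+1}(v) = span_K (S ∪ ∂S)` — at `q = p`
every `sigD_T` with `|T| = m + 1` is `T_l^{-1} · ∂_l ∘ sigD_{T − e_l}` (`T_l < p` is invertible).
[cite: Mizutani1973HironakaGroupSchemes, proof of Thm. 2.8 (p. 90: Diff_{i+1}(k)f from Diff_i(k)f and derivations)] -/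
theorem IsRootTower.thetaSpan_succ_eq_span (h : IsRootTower L K (p ^ 1) x₁ a₁) (m : ℕ) (v : ι → K) {S : Set (ι → K)}
    (hS : S ⊆ h.thetaSpan m v) (hspan : h.thetaSpan m v ≤ Submodule.span K S) :
    h.thetaSpan (m + 1) v = Submodule.span K (S ∪ h.derivSet S) := by
  classical
  apply le_antisymm
  · unfold IsRootTower.thetaSpan
    rw [Submodule.span_le]
    rintro _ ⟨T, hT, rfl⟩
    change (fun i => h.sigD T (v i)) ∈ Submodule.span K (S ∪ h.derivSet S)
    have hT' : T.degree ≤ m + 1 := mem_degLE.mp (Finset.mem_coe.mp hT)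
    by_cases hTm : T.degree ≤ m
    · exact Submodule.span_mono Set.subset_union_left (hspan (h.sigD_vec_mem_thetaSpan v hTm))
    · -- `|T| = m + 1 ≥ 1`: pick `l` with `T_l ≥ 1`, `T = T' + e_l`
      have hdeg : T.degree = m + 1 := by omega
      have hT0 : T ≠ 0 := by
        intro h0; rw [h0, map_zero] at hdeg; omega
      obtain ⟨l, hl⟩ : ∃ l, T l ≠ 0 := by
        by_contra hall
        push Not at hall
        exact hT0 (Finsupp.ext hall)
      set T' : Fin s →₀ ℕ := T - Finsupp.single l 1 with hT'def
      have hTT' : T' + Finsupp.single l 1 = T := by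
        rw [hT'def]
        exact tsub_add_cancel_of_le (Finsupp.single_le_iff.mpr (Nat.pos_of_ne_zero hl))
      have hT'deg : T'.degree ≤ m := by
        have := congrArg Finsupp.degree hTT'
        rw [map_add, Finsupp.degree_single] at this
        omega
      by_cases hbox : InBox (p ^ 1) T
      · -- `sigD_T v = (T_l)^{-1} ∂_l (sigD_{T'} v)`
        have hTl : ((T l : ℕ) : K) ≠ 0 := by
          intro h0
          rw [CharP.cast_eq_zero_iff K p] at h0
          have hlt : T l < p := by have := hbox l; rwa [pow_one] at this
          exact hl (Nat.eq_zero_of_dvd_of_lt h0 hlt)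
        have hθ' : (fun i => h.sigD T' (v i)) ∈ Submodule.span K S := hspan (h.sigD_vec_mem_thetaSpan v hT'deg)
        have hder := h.dvec_mem_span_union_derivSet le_rfl S l hθ'
        have hfun : (fun i => h.sigD T (v i)) = ((T l : ℕ) : K)⁻¹ • h.dvec l (fun i => h.sigD T' (v i)) := by
          funext i
          rw [Pi.smul_apply, h.dvec_apply, h.sigD_single_sigD, hTT', smul_eq_mul, ← mul_assoc]
          have hTl' : T' l + 1 = T l := by
            have := congrArg (fun M : Fin s →₀ ℕ => M l) hTT'
            simpa [Finsupp.add_apply] using this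
          rw [hTl', inv_mul_cancel₀ hTl, one_mul]
        rw [hfun]
        exact Submodule.smul_mem _ _ hder
      · have hzero : (fun i => h.sigD T (v i)) = 0 := by
          funext i; rw [h.sigD_eq_zero_of_not_inBox hbox, Pi.zero_apply]
        rw [hzero]
        exact Submodule.zero_mem _
  · rw [Submodule.span_le]
    rintro g (hg | ⟨l, g', hg', rfl⟩)
    · exact h.thetaSpan_mono (Nat.le_succ m) v (hS hg)
    · exact h.dvec_mem_thetaSpan_succ le_rfl v l (hS hg')

end Step

/-! ## Derivations of the tower: `D = Σ_l −D(a_l) ∂_l`; the joint kernel of the `∂_l`; `dz ∥ dα ⇒ z ∈ L(α)` -/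

section Derivations

variable {L K : Type u} [Field L] [Field K] [Algebra L K] {s p e : ℕ} [hp : Fact p.Prime] [CharP K p]
  {x : Fin s → L} {a : Fin s → K}

omit [CharP K p] in
/-- `K = L(a)`: every element of the tower lies in `L(a_1, …, a_s)`. [cite: Mizutani1973HironakaGroupSchemes, Remark 2.10 (in-house proof §1.1)] -/
theorem IsRootTower.mem_adjoin_range (h : IsRootTower L K (p ^ e) x a) (y : K) :
    y ∈ IntermediateField.adjoin L (Set.range a) := by
  have hsub : boxMonomials a (p ^ e) ⊆ ((IntermediateField.adjoin L (Set.range a)).toSubalgebra.toSubmodule : Set K) := by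
    rintro _ ⟨W, -, rfl⟩
    rw [SetLike.mem_coe, Subalgebra.mem_toSubmodule, IntermediateField.mem_toSubalgebra]
    exact prod_mem fun i _ => pow_mem (IntermediateField.subset_adjoin L (Set.range a) (Set.mem_range_self i)) _
  have := Submodule.span_le.mpr hsub (h.mem_span y)
  rwa [Subalgebra.mem_toSubmodule, IntermediateField.mem_toSubalgebra] at this

/-- A finite sum of derivations, evaluated. [folklore] -/
theorem derivation_sum_smul_apply {ι' : Type*} (T : Finset ι') (c : ι' → K) (D : ι' → Derivation L K K) (y : K) :
    (∑ l ∈ T, c l • D l) y = ∑ l ∈ T, c l * D l y := by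
  have hcoe := map_sum (Derivation.coeFnAddMonoidHom (R := L) (A := K) (M := K)) (fun l => c l • D l) T
  rw [Derivation.coeFnAddMonoidHom_apply] at hcoe
  have := congrFun hcoe y
  rw [this, Finset.sum_apply]
  refine Finset.sum_congr rfl fun l _ => ?_
  rw [Derivation.coeFnAddMonoidHom_apply, Derivation.coe_smul, Pi.smul_apply, smul_eq_mul]

/-- **Every `L`-derivation of the tower is a combination of the `∂_l`**: `D y = Σ_l (−D a_l) · ∂_l y` (a derivation is determined
by its values on the `p`-basis; `∂_l a_j = −δ_{lj}`). [cite: Matsumura1987, §26 p. 202 (maps on a p-basis extend uniquely to derivations)] -/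
theorem IsRootTower.derivation_apply_eq_sum_der (h : IsRootTower L K (p ^ e) x a) (he : 1 ≤ e) (D : Derivation L K K) (y : K) :
    D y = ∑ l, (-(D (a l))) * h.der he l y := by
  classical
  have key : (D - ∑ l, (-(D (a l))) • h.der he l) y = 0 := by
    refine derivation_eq_zero_of_mem_adjoin h _ Set.univ (fun j _ => ?_)
      (by rw [Set.image_univ]; exact h.mem_adjoin_range y)
    rw [Derivation.sub_apply, derivation_sum_smul_apply, sub_eq_zero]
    simp only [h.der_gen he]
    rw [Finset.sum_eq_single j (fun l _ hl => by rw [if_neg (Ne.symm hl), mul_zero])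
      (fun hj => absurd (Finset.mem_univ j) hj), if_pos rfl]
    ring
  rw [Derivation.sub_apply, derivation_sum_smul_apply, sub_eq_zero] at key
  exact key

/-- **Derivations with prescribed zeros** (Matsumura §26), `L`-linear form: if `K^p ⊆ L` and `z ∉ L(S)`, some `L`-derivation `D`
of `K` has `D z = 1` and vanishes on `L(S)`. [cite: Matsumura1987, §26 p. 202] -/
theorem exists_derivation_eq_one_of_not_mem_adjoin (hKp : ∀ y : K, y ^ p ∈ (algebraMap L K).range) {S : Set K} {z : K}
    (hz : z ∉ IntermediateField.adjoin L S) :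
    ∃ D : Derivation L K K, D z = 1 ∧ ∀ y ∈ IntermediateField.adjoin L S, D y = 0 := by
  set F : Subfield K := (IntermediateField.adjoin L S).toSubfield with hF
  have hFp : ∀ y : K, y ^ p ∈ F := fun y => by
    obtain ⟨c, hc⟩ := RingHom.mem_range.mp (hKp y)
    rw [← hc]
    exact (IntermediateField.adjoin L S).algebraMap_mem c
  have hzF : z ∉ F := hz
  obtain ⟨D, hD1, hD0⟩ := Literature.FieldTheory.Separability.exists_derivation_eq_one_eqOn_zero p F hFp hzF
  have hDL : ∀ c : L, D (algebraMap L K c) = 0 := fun c => hD0 _ ((IntermediateField.adjoin L S).algebraMap_mem c)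
  let Dlin : K →ₗ[L] K :=
    { toFun := D
      map_add' := map_add D
      map_smul' := fun c y => by
        rw [Algebra.smul_def, D.leibniz, hDL, smul_zero, add_zero, RingHom.id_apply, smul_eq_mul, Algebra.smul_def] }
  refine ⟨Derivation.mk' Dlin (fun y w => D.leibniz y w), hD1, fun y hy => hD0 y hy⟩

/-- **The joint kernel of the `∂_l` is `L`** (towers with `K^p ⊆ L`). [cite: Matsumura1987, §26 p. 202] -/
theorem IsRootTower.exists_eq_algebraMap_of_der_eq_zero (h : IsRootTower L K (p ^ e) x a) (he : 1 ≤ e)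
    (hKp : ∀ y : K, y ^ p ∈ (algebraMap L K).range) {z : K} (hz : ∀ l, h.der he l z = 0) :
    ∃ c : L, algebraMap L K c = z := by
  by_contra hne
  have hz' : z ∉ IntermediateField.adjoin L (∅ : Set K) := by
    rw [IntermediateField.adjoin_empty]
    intro hmem
    exact hne (IntermediateField.mem_bot.mp hmem)
  obtain ⟨D, hD1, -⟩ := exists_derivation_eq_one_of_not_mem_adjoin hKp hz'
  rw [h.derivation_apply_eq_sum_der he D z, Finset.sum_eq_zero (fun l _ => by rw [hz l, mul_zero])] at hD1
  exact zero_ne_one hD1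

/-- **If `dz` is proportional to `dα` then `z ∈ L(α)`** (the one-element case of the Jacobian criterion for `p`-dependence; towers with
`K^p ⊆ L`): a derivation killing `L(α)` with `D z = 1` would be a combination of the `∂_l`. [cite: Matsumura1987, §26 p. 202] -/
theorem IsRootTower.mem_adjoin_simple_of_der_eq_mul (h : IsRootTower L K (p ^ e) x a) (he : 1 ≤ e)
    (hKp : ∀ y : K, y ^ p ∈ (algebraMap L K).range) {α z κ : K} (hz : ∀ l, h.der he l z = κ * h.der he l α) :
    z ∈ IntermediateField.adjoin L {α} := by
  by_contra hne
  obtain ⟨D, hD1, hD0⟩ := exists_derivation_eq_one_of_not_mem_adjoin hKp hne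
  have hα : D α = 0 := hD0 α (IntermediateField.subset_adjoin _ _ (Set.mem_singleton α))
  rw [h.derivation_apply_eq_sum_der he D α] at hα
  rw [h.derivation_apply_eq_sum_der he D z] at hD1
  simp_rw [hz] at hD1
  have : ∑ l, -(D (a l)) * (κ * h.der he l α) = κ * ∑ l, -(D (a l)) * h.der he l α := by
    rw [Finset.mul_sum]; exact Finset.sum_congr rfl fun l _ => by ring
  rw [this, hα, mul_zero] at hD1
  exact zero_ne_one hD1

end Derivations

end Summit.ResolutionOfSingularities.KangarooAtlas.Mizutani

end
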